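import Literature.Analysis.InnerProduct.RankOneDowndate
import Summits.RiemannHypothesis.RiemannHypothesis.Theorems.PfPersistenceIntruderOrthogonality
import HarnessLib

/-!
# PF-persistence THEORY 3, reading (R-d) — "the intruder is the resolvent-filtered shadow of an
# off-line zero", typed and decided (publication cell `pub-rhpf`, theory seat 3, gen 3)

Framing (page 1 of every `pub-rhpf` file): **mechanism/rigidity campaign — nothing here is a claim
about RH.**  Everything in this file is PROVED abstract linear algebra or a DEFINITION; no statement
about `ζ` or about any control family is made; every empirical sentence in the docstrings is labelled
DATA and refers to `run/shared/lean/pub/pub-rhpf/pub-rhpf-theory-3/THEORY-INTRUDER.md` §9.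

Setting (ONE window, continuing `PfPersistenceIntruderOrthogonality`): `E` a real inner product space
(the even cosine sector of the windowed form at cutoff `λ = e^a`, truncation `N`), `T : E →ₗ[ℝ] E` the
form's Galerkin operator.  An `OffLineSplit T` records a decomposition `T = A − |v⟩⟨v|` with `A`
symmetric and form-nonnegative.  WHERE IT COMES FROM (PROVED-elementary, explicit formula; DATA for
which families it applies to): for a family whose completed L-function has an off-line zero quadruple
`½ ± δ ± iγ`, the windowed Weil form on the even sector is `A − 4|d⟩⟨d|` with
`d = Im ∫ ξ(x) e^{(δ+iγ)x} dx` and `A` = (archimedean + prime + on-line-zero part) `+ 4|r⟩⟨r|`,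
`r = Re ∫ ξ e^{(δ+iγ)x}`; take `v = 2d`.  Whether `A ≥ 0` at a given window is DATA (arb-certified per
window in THEORY-INTRUDER §9; it holds at every served Davenport–Heilbronn window of the t3 ladder).

* `OffLineSplit T`                 — the structure (`A`, `v`, `T = A − |v⟩⟨v|`, `A` symmetric, `A ≥ 0`).
* `no_two_orthogonal_intruders`    — SINGLE-DRIVER LAW: under a split, two mutually orthogonal intruders
  cannot coexist; the negative spectral subspace of the window is at most one-dimensional
  (tree lemma `Literature.Analysis.InnerProduct.rankOne_downdate_nonneg_on_pair`).  DATA consequence: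
  "n₋ = 1 at a served DH window" is FORCED whenever `A ≥ 0` there (arb certificate per window); a second
  negative eigenvalue needs `A` itself to go indefinite (e.g. through the second off-line zero's own
  driver) — THEORY-INTRUDER §9, Woodbury capacitance table.
* `intruder_moment_ne_zero`        — the intruder always sees the driver: `⟪v, u⟫ ≠ 0`.
* `intruder_eq_smul_resolvent`     — RESOLVENT SHADOW: with `y = (A + |ε|)⁻¹ v` (`A y + |ε| y = v`) the
  intruder IS `⟪v, u⟫ • y` (tree lemma `rankOne_downdate_eigenvector_eq_smul`; Golub–Van Loan Thm 8.4.3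
  (c)).  This is the precise sense in which the intruder is "the off-line zero's profile filtered through
  the rest of the form": its node count, its capture by any trial span, its drift with `a` are those of
  `(A + |ε|)⁻¹ d`, not of `d`.
* `secular_eq_one`                 — the secular equation `⟪v, (A + |ε|)⁻¹ v⟫ = 1` fixing `|ε|`.
* `negative_iff_secular_gt_one`    — the window is indefinite iff `⟪v, A⁻¹ v⟫ > 1` (given a witness
  `A z = v`): the crossing at a* is the crossing of ONE scalar, `s(a) = 4 dᵀ A⁻¹ d`, through `1`.
* `sq_inner_rung_le`               — GRADED ORTHOGONALITY: for every unit eigenvector `A φ = α φ`,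
  `⟪φ, v⟫² ≤ α + |ε|`: the driver is nearly orthogonal to every rung of `A` far below the scale `|ε|`
  (tree lemma `sq_inner_le_eigenvalue_add`).  The intruder (∝ `(A+|ε|)⁻¹ v`) has weight
  `⟪φ,v⟫/(α+|ε|)` on the rung `φ`, so it lives on the rungs with `α` of the order of `|ε|` and below, as
  far down as the driver reaches them — DATA per window (rung tables): THEORY-INTRUDER §9.

Don't-look sentence (RULING A24 k4): every statement here holds for ANY symmetric window admitting a
split with `A ≥ 0` — Davenport–Heilbronn, Epstein, planted-zero controls alike; the only family-dependent
inputs are the DATA "`A(a,N) ≥ 0`" and the value of the scalar `s(a)`; nothing in this file separates ζ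
(which has no intruder on any served window) from a control.

## References
* G. H. Golub, C. F. Van Loan, *Matrix Computations*, 4th ed. (2013), Thm 8.1.8, §8.4.3 Lemma 8.4.2,
  Thm 8.4.3. [GolubVanLoan2013]
* J. R. Bunch, C. P. Nielsen, D. C. Sorensen, Numer. Math. 31 (1978) 31–48. [BunchNielsenSorensen1978]
-/

noncomputable section

open scoped InnerProductSpace

set_option linter.dupNamespace false

namespace Summit.RiemannHypothesis.RiemannHypothesis.Theorems.PfPersistenceIntruderShadow

open Literature.Analysis.InnerProduct
open Summit.RiemannHypothesis.RiemannHypothesis.Theorems.PfPersistenceIntruderOrthogonality (Intruder)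

variable {E : Type*} [NormedAddCommGroup E] [InnerProductSpace ℝ E]

/-- A *split* of the window operator `T` off one driver: `T = A − |v⟩⟨v|` with `A` symmetric and
form-nonnegative (the rest of the explicit formula plus the `Re`-profile part of the off-line quadruple;
`v = 2 · Im`-profile). Existence of a split with `A ≥ 0` at a given window is DATA. [folklore] -/
structure OffLineSplit (T : E →ₗ[ℝ] E) where
  /-- the nonnegative remainder -/
  A : E →ₗ[ℝ] E
  /-- the driver (`2 ×` the imaginary-part profile of the off-line zero) -/
  v : E
  apply_eq : ∀ x : E, T x = A x - ⟪v, x⟫_ℝ • v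
  A_symm : ∀ x y : E, ⟪A x, y⟫_ℝ = ⟪x, A y⟫_ℝ
  A_nonneg : ∀ x : E, 0 ≤ ⟪A x, x⟫_ℝ

namespace OffLineSplit

variable {T : E →ₗ[ℝ] E} (S : OffLineSplit T)

/-- The form of `T` in split coordinates: `⟪T x, x⟫ = ⟪A x, x⟫ − ⟪v, x⟫²`. [folklore] -/
theorem inner_apply_self (x : E) : ⟪T x, x⟫_ℝ = ⟪S.A x, x⟫_ℝ - ⟪S.v, x⟫_ℝ ^ 2 := by
  rw [S.apply_eq, inner_sub_left, real_inner_smul_left, sq]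

/-- The eigen-equation of an intruder in split coordinates: `A u − ⟪v, u⟫ v = −(|ε| u)`. [folklore] -/
theorem intruder_eq (I : Intruder T) : S.A I.vec - ⟪S.v, I.vec⟫_ℝ • S.v = -((-I.eig) • I.vec) := by
  rw [← S.apply_eq, I.apply_eq, neg_smul, neg_neg]

/-- **Single-driver law.** Under a split `T = A − |v⟩⟨v|` with `A ≥ 0`, two mutually orthogonal
intruders cannot coexist: the negative spectral subspace of the window is at most one-dimensional
(n₋ ≤ 1).  [cite: GolubVanLoan2013, Thm 8.1.8] -/
theorem no_two_orthogonal_intruders (S : OffLineSplit T) (I J : Intruder T) (hIJ : ⟪I.vec, J.vec⟫_ℝ = 0) : False := by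
  obtain ⟨a, b, hab, h⟩ := rankOne_downdate_nonneg_on_pair S.A S.A_nonneg S.v I.vec J.vec
  rw [← S.inner_apply_self] at h
  have hJI : ⟪J.vec, I.vec⟫_ℝ = 0 := by rw [real_inner_comm]; exact hIJ
  have hII : ⟪I.vec, I.vec⟫_ℝ = 1 := by
    rw [real_inner_self_eq_norm_sq, I.norm_eq]; norm_num
  have hJJ : ⟪J.vec, J.vec⟫_ℝ = 1 := by
    rw [real_inner_self_eq_norm_sq, J.norm_eq]; norm_num
  have hform : ⟪T (a • I.vec + b • J.vec), a • I.vec + b • J.vec⟫_ℝ = a ^ 2 * I.eig + b ^ 2 * J.eig := by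
    rw [map_add, map_smul, map_smul, I.apply_eq, J.apply_eq]
    simp only [inner_add_left, inner_add_right, real_inner_smul_left, real_inner_smul_right,
      hII, hJJ, hIJ, hJI]
    ring
  rw [hform] at h
  have hI := I.eig_neg
  have hJ := J.eig_neg
  rcases hab with ha | hb
  · have ha2 : 0 < a ^ 2 := by positivity
    nlinarith [sq_nonneg b, mul_pos ha2 (neg_pos.mpr hI)]
  · have hb2 : 0 < b ^ 2 := by positivity
    nlinarith [sq_nonneg a, mul_pos hb2 (neg_pos.mpr hJ)]

/-- In particular two intruders with DIFFERENT eigenvalues cannot coexist when `T` is symmetric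
(they would be orthogonal): the negative eigenvalue of a split window is unique. [folklore] -/
theorem intruder_eig_unique (S : OffLineSplit T) (hT : T.IsSymmetric) (I J : Intruder T) : I.eig = J.eig := by
  by_contra hne
  exact S.no_two_orthogonal_intruders I J
    (inner_eq_zero_of_eigenvector_ne (𝕜 := ℝ) hT (μ := I.eig) (ν := J.eig)
      (by simpa using I.apply_eq) (by simpa using J.apply_eq) hne)

/-- The intruder always sees the driver: `⟪v, u⟫ ≠ 0`. [cite: GolubVanLoan2013, Lemma 8.4.2] -/
theorem intruder_moment_ne_zero (I : Intruder T) : ⟪S.v, I.vec⟫_ℝ ≠ 0 :=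
  rankOne_downdate_moment_ne_zero S.A S.A_nonneg (neg_pos.mpr I.eig_neg)
    (by intro h; have := I.norm_eq; rw [h, norm_zero] at this; exact zero_ne_one this) (S.intruder_eq I)

/-- **Resolvent shadow.** If `y` solves `A y + |ε| y = v` then the intruder is `⟪v, u⟫ • y`: the
intruder is the driver filtered through the resolvent of the rest of the form.
[cite: GolubVanLoan2013, Thm 8.4.3 (c)] -/
theorem intruder_eq_smul_resolvent (I : Intruder T) {y : E} (hy : S.A y + (-I.eig) • y = S.v) :
    I.vec = ⟪S.v, I.vec⟫_ℝ • y :=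
  rankOne_downdate_eigenvector_eq_smul S.A S.A_nonneg (neg_pos.mpr I.eig_neg) (S.intruder_eq I) hy

/-- **Secular equation** at the intruder eigenvalue: `⟪v, (A + |ε|)⁻¹ v⟫ = 1`.
[cite: GolubVanLoan2013, Thm 8.4.3 (a)] -/
theorem secular_eq_one (I : Intruder T) {y : E} (hy : S.A y + (-I.eig) • y = S.v) :
    ⟪S.v, y⟫_ℝ = 1 :=
  rankOne_downdate_secular_eq_one S.A S.A_nonneg (neg_pos.mpr I.eig_neg)
    (by intro h; have := I.norm_eq; rw [h, norm_zero] at this; exact zero_ne_one this)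
    (S.intruder_eq I) hy

/-- **Secular criterion for the crossing.** Given a witness `A z = v` of `A⁻¹ v`, the window form takes
a negative value iff the scalar `⟪v, z⟫ = ⟪v, A⁻¹ v⟫` exceeds `1`. [cite: BunchNielsenSorensen1978] -/
theorem negative_iff_secular_gt_one {z : E} (hz : S.A z = S.v) :
    (∃ x : E, ⟪T x, x⟫_ℝ < 0) ↔ 1 < ⟪S.v, z⟫_ℝ := by
  rw [← rankOne_downdate_indefinite_iff S.A S.A_symm S.A_nonneg hz]
  simp only [S.inner_apply_self, sub_neg]

/-- **Graded orthogonality of the driver to the rungs of `A`.** For every unit eigenvector `A φ = α φ`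
and an intruder with eigenvalue `ε < 0` (resolvent vector `y`), `⟪φ, v⟫² ≤ α + |ε|`. [folklore] -/
theorem sq_inner_rung_le (I : Intruder T) {y φ : E} {α : ℝ} (hy : S.A y + (-I.eig) • y = S.v)
    (hφ : S.A φ = α • φ) (hφ1 : ‖φ‖ = 1) : ⟪φ, S.v⟫_ℝ ^ 2 ≤ α + -I.eig :=
  sq_inner_le_eigenvalue_add S.A S.A_symm S.A_nonneg (le_of_lt (neg_pos.mpr I.eig_neg)) hy
    (S.secular_eq_one I hy) hφ hφ1

end OffLineSplit

end Summit.RiemannHypothesis.RiemannHypothesis.Theorems.PfPersistenceIntruderShadow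

end
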